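import Summits.AtomisticToContinuum.Crystallization.Theorems.FluxTubeKeplerFluxCellKeplerSingleScale
import Summits.AtomisticToContinuum.Crystallization.Theorems.ChessboardParticlePlanesPeriodicWindowsIffCrystallization

/-!
# F4 on-path lemma for the forward rung `ScaleBlindRung` (scale ladder over `FluxTubeKepler.FloorGivesLayered`)

`Crystallization → ScaleRung I` for every `I` (in particular `→ ScaleBlindRung = ScaleRung (Set.Ioi 0)`): the landed
hull-criterion converse `ChessboardParticlePlanesPeriodicWindowsIffCrystallization.periodicWindows_of_crystallization`
gives periodic windows along every Lennard-Jones ground-state sequence outright, so every member of the family is a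
CONSEQUENCE of the sub-problem (the rung lies on the path floor → summit).  Also the dial monotonicity
`scaleRung_anti`.  Self-contained copy (sub-namespace `OnPath`) of the definitions of `Lines/ScaleBlindRung.lean`;
the canonical `ScaleLadder.scaleRung_of_crystallization` / `ScaleLadder.ScaleBlindRung_of_Crystallization` live
there with the same text.  No `sorry`.
-/

noncomputable section

namespace Summit.AtomisticToContinuum.Crystallization.Cruxes.FluxCellKepler.ScaleLadder.OnPath

open scoped BigOperators Classical
open Filter Topology
open Literature.MathematicalPhysics.StatisticalMechanics

local notation "E3" => EuclideanSpace ℝ (Fin 3)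

/-- FLOOR(P₀): `N · e(P₀) ≤ E(x)` for every Lennard-Jones ground state (verbatim the floor's first hypothesis). -/
def Floor (P₀ : PeriodicConfiguration 3) : Prop :=
  ∀ (N : ℕ) (x : Fin N → E3), IsGroundState lennardJones x →
    (N : ℝ) * P₀.energyPerParticle lennardJones ≤ interactionEnergy lennardJones x

/-- `I`-SCALE-GOOD SITE: some layered template (Hägg word `s`, Barlow registry, rigid motion `A`) with in-plane
spacing `a ∈ I` and interlayer gaps in the SCALED box `[39a/50, 17a/20]` matches the `R`-ball around `x i` two-way
with tolerance `η`.  `I = [47/50, 1]`: the floor's predicate `LayeredGood R η` (`scaleGood_box_iff`);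
`I = (0, ∞)`: every spacing (scale-blind). -/
def ScaleGood (I : Set ℝ) (R η : ℝ) {N : ℕ} (x : Fin N → E3) (i : Fin N) : Prop :=
  ∃ a : ℝ, a ∈ I ∧ ∃ (A : E3 →ₗᵢ[ℝ] E3) (s : ℤ → ℤ) (z : ℤ → ℝ), IsHaggSeq s ∧
    (∀ m : ℤ, 39 / 50 * a ≤ z (m + 1) - z m ∧ z (m + 1) - z m ≤ 17 / 20 * a) ∧
    let S : Set E3 := {p | ∃ m k l : ℤ, p = A (((k : ℝ) • triangularVec₁ a) + ((l : ℝ) • triangularVec₂ a) +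
      ((haggLabel s m : ℝ) • barlowOffset a) + (z m • layerNormal 1))}
    (∀ p ∈ S, ‖p‖ ≤ R → ∃ j : Fin N, dist (x j - x i) p ≤ η) ∧
    (∀ j : Fin N, ‖x j - x i‖ ≤ R → ∃ p ∈ S, dist (x j - x i) p ≤ η)

/-- SCALE-BLIND BUDGET with dial `I`: at every scale `(R,η)` some `c > 0` prices the sites that are not
`I`-scale-good against the excess energy over `N · e(P₀)` (`I = [47/50, 1]`: the floor's budget). -/
def ScaleBudget (I : Set ℝ) (P₀ : PeriodicConfiguration 3) : Prop :=
  ∀ R η : ℝ, 0 < R → 0 < η → ∃ c : ℝ, 0 < c ∧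
    ∀ (N : ℕ) (x : Fin N → E3), IsGroundState lennardJones x →
      c * (Nat.card {i : Fin N // ¬ ScaleGood I R η x i} : ℝ) ≤
        interactionEnergy lennardJones x - (N : ℝ) * P₀.energyPerParticle lennardJones

/-- Periodic windows at every scale along `x` (verbatim the conclusion of `FluxTubeKepler.PeriodicGivenLayered`). -/
def HasPeriodicWindows (x : (N : ℕ) → (Fin N → E3)) : Prop :=
  ∃ P : PeriodicConfiguration 3, ∀ R ε : ℝ, 0 < ε → ∃ᶠ N in atTop, ∃ t : E3,
    (∀ s ∈ P.points, ‖s‖ ≤ R → ∃ i : Fin N, dist (x N i + t) s ≤ ε) ∧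
    (∀ i : Fin N, ‖x N i + t‖ ≤ R → ∃ s ∈ P.points, dist (x N i + t) s ≤ ε)

/-- **The graded family.** `ScaleRung I`: FLOOR and the budget that leaves the spacings in `I` unpriced force
periodic windows along every Lennard-Jones ground-state sequence. -/
def ScaleRung (I : Set ℝ) : Prop :=
  ∀ P₀ : PeriodicConfiguration 3, Floor P₀ → ScaleBudget I P₀ →
    ∀ x : (N : ℕ) → (Fin N → E3), (∀ N, IsGroundState lennardJones (x N)) → HasPeriodicWindows x

/-- **Deciding rung.** The budget need not price the LATTICE CONSTANT at all: pricing only the sites whose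
`R`-neighbourhood is not `η`-close to SOME uniformly dilated or compressed admissible layered template (any spacing
`a > 0`, gaps in the scaled box) suffices — the spacing of the windows is then selected by the energy. -/
def ScaleBlindRung : Prop := ScaleRung (Set.Ioi 0)

/-! ## Dial monotonicity -/

theorem scaleGood_mono {I I' : Set ℝ} (hI : I ⊆ I') {R η : ℝ} {N : ℕ} (x : Fin N → E3) (i : Fin N) :
    ScaleGood I R η x i → ScaleGood I' R η x i := by
  rintro ⟨a, ha, A, s, z, hs, hz, h₁, h₂⟩
  exact ⟨a, hI ha, A, s, z, hs, hz, h₁, h₂⟩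

/-- The budget is monotone in the dial: a budget pricing the larger bad set prices the smaller one. -/
theorem scaleBudget_mono {I I' : Set ℝ} (hI : I ⊆ I') (P₀ : PeriodicConfiguration 3) :
    ScaleBudget I P₀ → ScaleBudget I' P₀ := by
  intro hB R η hR hη
  obtain ⟨c, hc, hcB⟩ := hB R η hR hη
  refine ⟨c, hc, fun N x hx => le_trans ?_ (hcB N x hx)⟩
  have hle : Nat.card {i : Fin N // ¬ ScaleGood I' R η x i} ≤ Nat.card {i : Fin N // ¬ ScaleGood I R η x i} := by
    rw [Nat.card_eq_fintype_card, Nat.card_eq_fintype_card]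
    exact Fintype.card_subtype_mono _ _ fun i hi hg => hi (scaleGood_mono hI x i hg)
  exact mul_le_mul_of_nonneg_left (by exact_mod_cast hle) hc.le

theorem scaleRung_anti {I I' : Set ℝ} (hI : I ⊆ I') : ScaleRung I' → ScaleRung I :=
  fun H P₀ hF hB x hx => H P₀ hF (scaleBudget_mono hI P₀ hB) x hx

/-! ## F4 — the sub-problem implies every member -/

theorem scaleRung_of_crystallization (I : Set ℝ) (h : _root_.Crystallization) : ScaleRung I :=
  fun _ _ _ x hx =>
    Theorems.ChessboardParticlePlanesPeriodicWindowsIffCrystallization.periodicWindows_of_crystallization h x hx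

@[aesop safe apply]
theorem ScaleBlindRung_of_Crystallization (h : _root_.Crystallization) : ScaleBlindRung :=
  scaleRung_of_crystallization _ h

end Summit.AtomisticToContinuum.Crystallization.Cruxes.FluxCellKepler.ScaleLadder.OnPath

end
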